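import Literature.NumberTheory.Automorphic.CongruenceSubgroupExpansionGL
import Literature.NumberTheory.Automorphic.HeckeProjectorGrowth
import Literature.NumberTheory.Automorphic.GodementJacquetLemma610Bounded
import Literature.NumberTheory.Automorphic.SmoothRepresentationIrreducibleContragredientProofs
import HarnessLib

/-!
# Exponential growth of admissible matrix coefficients of `GL_n(F)` along the Cartan
decomposition

Topic `NumberTheory/Automorphic`; theorems only (no definition, no named fact). Part of the
discharge of the named fact `GodementJacquet1972_local_convergence` (`GodementJacquetLocal`;
Godement–Jacquet, LNM 260 (1972), Thm. 3.3 (1)), completed in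
`GodementJacquetLocalConvergenceProofs`. Setting: `F` a non-archimedean local field, `ϖ` a
uniformizing element, `K = GL_n(𝒪) = glInt n F`, `K_m = congruenceGL n |ϖ|^m` the principal
congruence subgroups (`GLnCongruenceSubgroups`, `CongruenceSubgroupExpansionGL`),
`Δ_d = glIntDet n ϖ d` the integral matrices with `|det| = |ϖ|^d` (`TamagawaHeckeSeries`), and
`ρ` a smooth representation of `GL_n(F)` on a complex vector space with `V^{K_m}`
finite-dimensional (e.g. `ρ` admissible).

* `exists_list_sum_eq_of_antitone`: an antitone `a ∈ ℤⁿ` is a sum of at most `∑ |a_i|` antitone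
  vectors with entries in `{-1, 0, 1}` — so `ϖ^a` is a product of boundedly many of the finitely
  many torus elements `ϖ^b`, `b` antitone with entries in `{-1, 0, 1}`, each of spread `≤ 2`.
* `exists_norm_apply_zpowDiagGL_le` (**growth along the torus**, `m ≥ 2`): there is `M ≥ 1`
  with `|ψ(ρ(ϖ^a) w)| ≤ C(w, ψ) M^{∑ |a_i|}` for all antitone `a`, `K_m`-fixed `w` and
  `K_m`-invariant `ψ`: Hecke multiplicativity at level `K_m`
  (`HeckeProjectorGrowth.exists_norm_apply_list_prod_le` with the expansion property
  `exists_zpowDiagGL_mul_mul_zpowDiagGL_eq_of_mem_congruenceGL`).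
* `exists_norm_coeff_le_of_mem_glIntDet` (**growth on `ϖ^{-N} Δ_d`**): for `v₀ ∈ V^{K_m}` and a
  `K_m`-fixed smooth linear form `φ₀`, `|φ₀(ρ(x) v₀)| ≤ C M^{d + nN}` whenever `ϖ^N x ∈ Δ_d`:
  Cartan decomposition `ϖ^N x = k₁⁻¹ ϖ^a k₂⁻¹` (`CartanDecompositionGLnPowers`) and the finiteness
  of the `K`-orbits of `v₀`, `φ₀`, which stay `K_m`-fixed by normality of `K_m` in `K`.

This is the elementary (Hecke-algebra) proof that matrix coefficients of admissible
representations grow at most exponentially (Casselman (1995), §4; Bernstein–Zelevinsky (1976),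
§3), in place of the asymptotics via Jacquet modules; it is all that the convergence of the
Godement–Jacquet zeta integrals needs.

## References

* R. Godement, H. Jacquet, *Zeta functions of simple algebras*, LNM 260 (1972), Thm. 3.3 (1)
  [GodementJacquet1972].
* W. Casselman, *Introduction to the theory of admissible representations of 𝔭-adic reductive
  groups* (1995 notes), §1.4, Lemma 4.1.5, §4.
* I. N. Bernstein, A. V. Zelevinsky, *Representations of the group `GL(n, F)` where `F` is a
  non-archimedean local field*, Russian Math. Surveys 31:3 (1976), §3 [BernsteinZelevinsky1976].
-/

set_option autoImplicit false

noncomputable section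

open scoped MatrixGroups Matrix NNReal
open Matrix ValuativeRel

namespace Literature.NumberTheory.Automorphic

variable {F : Type*} [Field F] [ValuativeRel F] {n : ℕ}

/-! ### Growth of matrix coefficients along the Cartan decomposition of `GL_n(F)` -/

section GLGrowth

omit [ValuativeRel F] in
/-- `ϖ^{b₁ + ⋯ + b_ℓ} = ϖ^{b₁} ⋯ ϖ^{b_ℓ}` for lists of exponent vectors. [folklore] -/
theorem zpowDiagGL_list_sum {ϖ : F} (hϖ0 : ϖ ≠ 0) (l : List (Fin n → ℤ)) :
    zpowDiagGL hϖ0 l.sum = ((l.map (zpowDiagGL hϖ0)).prod : GL (Fin n) F) := by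
  induction l with
  | nil => rw [List.sum_nil, List.map_nil, List.prod_nil, zpowDiagGL_zero]
  | cons b l ih => rw [List.sum_cons, List.map_cons, List.prod_cons, zpowDiagGL_add, ih]

/-- **Antitone exponent vectors decompose into elementary ones.** Every antitone
`a : Fin n → ℤ` is a sum of at most `∑ |a_i|` antitone vectors with values in `{-1, 0, 1}`
(peel off the indicator of `{a_i > 0}`, resp. minus the indicator of `{a_i < 0}`). In terms of
`GL_n`: `ϖ^a` is a product of at most `∑ |a_i|` of the finitely many elements `ϖ^b`, `b`
antitone with entries in `{-1, 0, 1}`. [folklore] -/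
theorem exists_list_sum_eq_of_antitone (a : Fin n → ℤ) (ha : Antitone a) :
    ∃ l : List (Fin n → ℤ), (∀ b ∈ l, Antitone b ∧ ∀ i, b i = 0 ∨ b i = 1 ∨ b i = -1) ∧
      l.sum = a ∧ l.length ≤ ∑ i, (a i).natAbs := by
  suffices h : ∀ N : ℕ, ∀ a : Fin n → ℤ, Antitone a → ∑ i, (a i).natAbs ≤ N →
      ∃ l : List (Fin n → ℤ), (∀ b ∈ l, Antitone b ∧ ∀ i, b i = 0 ∨ b i = 1 ∨ b i = -1) ∧
        l.sum = a ∧ l.length ≤ ∑ i, (a i).natAbs from h _ a ha le_rfl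
  intro N
  induction N with
  | zero =>
    intro a ha hN
    have ha0 : a = 0 := by
      funext i
      have : (a i).natAbs = 0 := by
        have h := Finset.single_le_sum (f := fun i => (a i).natAbs) (fun _ _ => Nat.zero_le _)
          (Finset.mem_univ i)
        omega
      exact Int.natAbs_eq_zero.mp this
    exact ⟨[], fun b hb => by simp at hb, by rw [List.sum_nil, ha0], by simp⟩
  | succ N ih =>
    intro a ha hN
    by_cases hpos : ∃ i, 0 < a i
    · -- peel off the indicator of `{a_i > 0}`
      set u : Fin n → ℤ := fun i => if 0 < a i then 1 else 0 with hu
      have hua : Antitone u := by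
        intro i j hij
        simp only [hu]
        have := ha hij
        split_ifs <;> omega
      have ha' : Antitone (a - u) := by
        intro i j hij
        simp only [Pi.sub_apply, hu]
        have := ha hij
        split_ifs <;> omega
      have hpt : ∀ i, (a i).natAbs = ((a - u) i).natAbs + (if 0 < a i then 1 else 0) := by
        intro i
        simp only [Pi.sub_apply, hu]
        split_ifs with h <;> omega
      have hcard : 1 ≤ ∑ i, (if 0 < a i then 1 else 0 : ℕ) := by
        obtain ⟨i, hi⟩ := hpos
        have := Finset.single_le_sum (f := fun i => (if 0 < a i then 1 else 0 : ℕ))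
          (fun _ _ => Nat.zero_le _) (Finset.mem_univ i)
        simp only [hi, if_true] at this
        exact this
      have hsum : ∑ i, (a i).natAbs = ∑ i, ((a - u) i).natAbs + ∑ i, (if 0 < a i then 1 else 0 : ℕ) := by
        rw [← Finset.sum_add_distrib]
        exact Finset.sum_congr rfl fun i _ => hpt i
      obtain ⟨l, hl, hlsum, hlen⟩ := ih (a - u) ha' (by omega)
      refine ⟨u :: l, fun b hb => ?_, by rw [List.sum_cons, hlsum, add_sub_cancel], ?_⟩
      · rcases List.mem_cons.mp hb with rfl | hb
        · exact ⟨hua, fun i => by simp only [hu]; split_ifs <;> simp⟩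
        · exact hl b hb
      · rw [List.length_cons]; omega
    · by_cases hneg : ∃ i, a i < 0
      · -- peel off minus the indicator of `{a_i < 0}`
        set u : Fin n → ℤ := fun i => if a i < 0 then -1 else 0 with hu
        have hua : Antitone u := by
          intro i j hij
          simp only [hu]
          have := ha hij
          split_ifs <;> omega
        have ha' : Antitone (a - u) := by
          intro i j hij
          simp only [Pi.sub_apply, hu]
          have := ha hij
          push Not at hpos
          have hi := hpos i
          have hj := hpos j
          split_ifs <;> omega
        have hpt : ∀ i, (a i).natAbs = ((a - u) i).natAbs + (if a i < 0 then 1 else 0) := by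
          intro i
          simp only [Pi.sub_apply, hu]
          split_ifs with h <;> omega
        have hcard : 1 ≤ ∑ i, (if a i < 0 then 1 else 0 : ℕ) := by
          obtain ⟨i, hi⟩ := hneg
          have := Finset.single_le_sum (f := fun i => (if a i < 0 then 1 else 0 : ℕ))
            (fun _ _ => Nat.zero_le _) (Finset.mem_univ i)
          simp only [hi, if_true] at this
          exact this
        have hsum : ∑ i, (a i).natAbs = ∑ i, ((a - u) i).natAbs + ∑ i, (if a i < 0 then 1 else 0 : ℕ) := by
          rw [← Finset.sum_add_distrib]
          exact Finset.sum_congr rfl fun i _ => hpt i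
        obtain ⟨l, hl, hlsum, hlen⟩ := ih (a - u) ha' (by omega)
        refine ⟨u :: l, fun b hb => ?_, by rw [List.sum_cons, hlsum, add_sub_cancel], ?_⟩
        · rcases List.mem_cons.mp hb with rfl | hb
          · exact ⟨hua, fun i => by simp only [hu]; split_ifs <;> simp⟩
          · exact hl b hb
        · rw [List.length_cons]; omega
      · -- `a = 0`
        push Not at hpos hneg
        have ha0 : a = 0 := funext fun i => le_antisymm (hpos i) (hneg i)
        exact ⟨[], fun b hb => by simp at hb, by rw [List.sum_nil, ha0], by simp⟩

variable [TopologicalSpace F] [IsNonarchimedeanLocalField F]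

/-- **Exponential growth of matrix coefficients of `GL_n(F)` along the Cartan torus.** Let `ρ`
be a smooth representation of `GL_n(F)` with `V^{K_m}` finite-dimensional, `K_m` the principal
congruence subgroup of level `m ≥ 2` of a uniformizing element `ϖ`. There is `M ≥ 1` such that
for every `K_m`-fixed `w` and every `K_m`-invariant linear form `ψ` there is `C ≥ 0` with
`|ψ(ρ(ϖ^a) w)| ≤ C · M^{∑ |a_i|}` for all antitone `a ∈ ℤⁿ`. Proof: Hecke multiplicativity at
level `K_m` (`exists_norm_apply_list_prod_le` with the double-coset inclusions
`exists_zpowDiagGL_mul_mul_zpowDiagGL_eq`) along the decomposition of `a` into elementary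
antitone vectors (`exists_list_sum_eq_of_antitone`). (The standard argument; Casselman,
*Introduction to the theory of admissible representations*, §4; Bernstein–Zelevinsky (1976),
§3.) [folklore] -/
theorem exists_norm_apply_zpowDiagGL_le {ϖ : F} (hϖ : IsUniformizingElement ϖ) {m : ℕ}
    (hm : 2 ≤ m) {V : Type*} [AddCommGroup V] [Module ℂ V] (ρ : Representation ℂ (GL (Fin n) F) V)
    (hρ : ρ.IsSmooth) [Module.Finite ℂ (ρ.fixedPoints (congruenceGL n (valuation F ϖ ^ m)))] :
    ∃ M : ℝ, 1 ≤ M ∧ ∀ w ∈ ρ.fixedPoints (congruenceGL n (valuation F ϖ ^ m)),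
      ∀ ψ : Module.Dual ℂ V,
        (∀ g ∈ congruenceGL n (valuation F ϖ ^ m), ∀ v, ψ (ρ g v) = ψ v) →
        ∃ C : ℝ, 0 ≤ C ∧ ∀ a : Fin n → ℤ, Antitone a →
          ‖ψ (ρ (zpowDiagGL hϖ.ne_zero a) w)‖ ≤ C * M ^ (∑ i, (a i).natAbs) := by
  classical
  set Km : Subgroup (GL (Fin n) F) := congruenceGL n (valuation F ϖ ^ m) with hKm
  have hKc : IsCompact (Km : Set (GL (Fin n) F)) := isCompact_congruenceGL _
  obtain ⟨e, he₁, he₂, he₃⟩ := hρ.exists_fixedPoints_projection hKc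
  have hfin : ∀ v : V, ((fun g : GL (Fin n) F => ρ g v) '' (Km : Set (GL (Fin n) F))).Finite :=
    fun v => hρ.finite_image_apply hKc v
  -- generators `ϖ^b`, `b` antitone with entries in `{-1,0,1}`, and dominant elements `ϖ^β`
  set B : Finset (Fin n → ℤ) :=
    (Fintype.piFinset fun _ : Fin n => ({-1, 0, 1} : Finset ℤ)).filter fun b => Antitone b with hB
  set S : Finset (GL (Fin n) F) := B.image (zpowDiagGL hϖ.ne_zero) with hS
  set D : Set (GL (Fin n) F) := {g | ∃ β : Fin n → ℤ, Antitone β ∧ g = zpowDiagGL hϖ.ne_zero β}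
    with hD
  have h1 : (1 : GL (Fin n) F) ∈ D := ⟨0, antitone_const, (zpowDiagGL_zero _).symm⟩
  have hmul : ∀ a ∈ S, ∀ b ∈ D, a * b ∈ D := by
    rintro a ha b ⟨β, hβ, rfl⟩
    obtain ⟨α, hα, rfl⟩ := Finset.mem_image.mp ha
    have hα' : Antitone α := (Finset.mem_filter.mp hα).2
    exact ⟨α + β, fun i j hij => add_le_add (hα' hij) (hβ hij), (zpowDiagGL_add _ _ _).symm⟩
  have hDC : ∀ a ∈ S, ∀ b ∈ D, ∀ κ ∈ Km, ∃ κ₁ ∈ Km, ∃ κ₂ ∈ Km,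
      a * κ * b = κ₁ * (a * b) * κ₂ := by
    rintro a ha b ⟨β, hβ, rfl⟩ κ hκ
    obtain ⟨α, hα, rfl⟩ := Finset.mem_image.mp ha
    obtain ⟨hαv, hαa⟩ := Finset.mem_filter.mp hα
    have hαm : ∀ i j, α j ≤ α i + m := by
      intro i j
      have hi := Fintype.mem_piFinset.mp hαv i
      have hj := Fintype.mem_piFinset.mp hαv j
      simp only [Finset.mem_insert, Finset.mem_singleton] at hi hj
      omega
    exact exists_zpowDiagGL_mul_mul_zpowDiagGL_eq_of_mem_congruenceGL hϖ (by omega) hαa hαm hβ hκ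
  obtain ⟨M, hM1, hM⟩ := exists_norm_apply_list_prod_le ρ Km he₁ he₂ he₃ hfin S D h1 hmul hDC
  refine ⟨M, hM1, fun w hw ψ hψ => ?_⟩
  obtain ⟨C, hC0, hC⟩ := hM w hw ψ hψ
  refine ⟨C, hC0, fun a ha => ?_⟩
  obtain ⟨l, hl, hsum, hlen⟩ := exists_list_sum_eq_of_antitone a ha
  have hprod : zpowDiagGL hϖ.ne_zero a = ((l.map (zpowDiagGL hϖ.ne_zero)).prod : GL (Fin n) F) := by
    rw [← hsum, zpowDiagGL_list_sum]
  have hlS : ∀ x ∈ l.map (zpowDiagGL hϖ.ne_zero), x ∈ S := by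
    intro x hx
    obtain ⟨b, hb, rfl⟩ := List.mem_map.1 hx
    refine Finset.mem_image_of_mem _ (Finset.mem_filter.mpr ⟨?_, (hl b hb).1⟩)
    refine Fintype.mem_piFinset.mpr fun i => ?_
    rcases (hl b hb).2 i with h | h | h <;> simp [h]
  calc ‖ψ (ρ (zpowDiagGL hϖ.ne_zero a) w)‖
      = ‖ψ (ρ (l.map (zpowDiagGL hϖ.ne_zero)).prod w)‖ := by rw [hprod]
    _ ≤ C * M ^ (l.map (zpowDiagGL hϖ.ne_zero)).length := hC _ hlS
    _ ≤ C * M ^ (∑ i, (a i).natAbs) := by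
        rw [List.length_map]
        exact mul_le_mul_of_nonneg_left (pow_le_pow_right₀ hM1 hlen) hC0

end GLGrowth

/-! ### Coefficient bound on `Δ_m` and integrability of the local zeta integrals -/

section Assembly

open _root_.MeasureTheory _root_.Topology Filter
  Literature.NumberTheory.GaloisRepresentations.IsNonarchimedeanLocalField

variable {ϖ : F}

/-- `Δ_a · Δ_b ⊆ Δ_{a+b}`: products of integral matrices are integral and `|det|` is
multiplicative. [folklore] -/
theorem mul_mem_glIntDet {a b : ℕ} {x y : GL (Fin n) F} (hx : x ∈ glIntDet n ϖ a)
    (hy : y ∈ glIntDet n ϖ b) : x * y ∈ glIntDet n ϖ (a + b) := by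
  refine ⟨?_, ?_⟩
  · rw [Units.val_mul]; exact hx.1.mul hy.1
  · rw [Units.val_mul, Matrix.det_mul, map_mul, hx.2, hy.2, pow_add]

omit [ValuativeRel F] in
/-- Central powers of `ϖ` add: `ϖ^{(c, …, c)} ϖ^{(c', …, c')} = ϖ^{(c + c', …)}`. [folklore] -/
theorem zpowDiagGL_const_mul_const (hϖ0 : ϖ ≠ 0) (c c' : ℤ) :
    (zpowDiagGL hϖ0 (fun _ : Fin n => c) * zpowDiagGL hϖ0 (fun _ : Fin n => c') : GL (Fin n) F) =
      zpowDiagGL hϖ0 (fun _ : Fin n => c + c') := by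
  rw [← zpowDiagGL_add]; rfl

/-- The matrix `ϖ^{(r, …, r)} x` is `ϖ^r • x`; so `x ↦ ϖ^{(r,…,r)} x` is integral iff `ϖ^r x`
is. [folklore] -/
theorem isIntegralMatrix_zpowDiagGL_const_mul_iff (hϖ0 : ϖ ≠ 0) (r : ℕ) (x : GL (Fin n) F) :
    IsIntegralMatrix ((zpowDiagGL hϖ0 (fun _ : Fin n => (r : ℤ)) * x : GL (Fin n) F) :
      Matrix (Fin n) (Fin n) F) ↔ IsIntegralMatrix (ϖ ^ r • (x : Matrix (Fin n) (Fin n) F)) := by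
  have e : ∀ i j, ((zpowDiagGL hϖ0 (fun _ : Fin n => (r : ℤ)) * x : GL (Fin n) F) :
      Matrix (Fin n) (Fin n) F) i j = (ϖ ^ r • (x : Matrix (Fin n) (Fin n) F)) i j := by
    intro i j
    rw [zpowDiagGL_const_mul_apply, zpow_natCast, Matrix.smul_apply, smul_eq_mul]
  exact ⟨fun h i j => (e i j) ▸ h i j, fun h i j => (e i j).symm ▸ h i j⟩

variable [TopologicalSpace F] [IsNonarchimedeanLocalField F]

/-- Every `g ∈ GL_n(F)` lies in `ϖ^{-N} Δ_m` for some `N`, `m`. [folklore] -/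
theorem exists_zpowDiagGL_const_mul_mem_glIntDet (hϖ : IsUniformizingElement ϖ) (g : GL (Fin n) F) :
    ∃ N m : ℕ, zpowDiagGL hϖ.ne_zero (fun _ : Fin n => (N : ℤ)) * g ∈ glIntDet n ϖ m := by
  obtain ⟨N, hN⟩ := exists_zpowDiagGL_mul_isIntegralMatrix hϖ g
  obtain ⟨m, hm⟩ := exists_mem_glIntDet hϖ hN
  exact ⟨N, m, hm⟩

/-- **Coefficient bound on `ϖ^{-N} Δ_m`.** Let `ρ` be smooth with `V^{K_m}` finite-dimensional
(`K_m` the principal congruence subgroup of level `m ≥ 2`), `v₀ ∈ V^{K_m}` and `φ₀ ∈ Ṽ^{K_m}`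
(a `K_m`-fixed smooth linear form). There are `M ≥ 1`, `C ≥ 0` with
`|φ₀(ρ(x) v₀)| ≤ C · M^{d + nN}` whenever `ϖ^{(N,…,N)} x ∈ Δ_d`. Proof: Cartan decomposition
`ϖ^N x = k₁⁻¹ ϖ^a k₂⁻¹` (`exists_glInt_mul_mul_eq_piPowGL_of_mem_glIntDet`, `a ≥ 0` antitone,
`∑ a_i = d`), so `φ₀(ρ(x) v₀) = ψ(ρ(ϖ^{a-N}) w)` with `w = ρ(k₂⁻¹) v₀`, `ψ = φ₀ ∘ ρ(k₁⁻¹)` in the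
finite `GL_n(𝒪)`-orbits of `v₀`, `φ₀` (which stay `K_m`-fixed, `K_m` being normal in
`GL_n(𝒪)`), and `exists_norm_apply_zpowDiagGL_le` applies with `∑ |a_i - N| ≤ d + nN`.
[folklore] -/
theorem exists_norm_coeff_le_of_mem_glIntDet (hϖ : IsUniformizingElement ϖ) {m : ℕ} (hm : 2 ≤ m)
    {V : Type*} [AddCommGroup V] [Module ℂ V] (ρ : Representation ℂ (GL (Fin n) F) V)
    (hρ : ρ.IsSmooth) [Module.Finite ℂ (ρ.fixedPoints (congruenceGL n (valuation F ϖ ^ m)))]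
    {v₀ : V} (hv₀ : v₀ ∈ ρ.fixedPoints (congruenceGL n (valuation F ϖ ^ m)))
    {φ₀ : Module.Dual ℂ V} (hφ₀ : φ₀ ∈ ρ.contragredient)
    (hφ₀K : ∀ g ∈ congruenceGL n (valuation F ϖ ^ m), ρ.dual g φ₀ = φ₀) :
    ∃ M : ℝ, 1 ≤ M ∧ ∃ C : ℝ, 0 ≤ C ∧ ∀ (N d : ℕ) (x : GL (Fin n) F),
      zpowDiagGL hϖ.ne_zero (fun _ : Fin n => (N : ℤ)) * x ∈ glIntDet n ϖ d →
      ‖φ₀ (ρ x v₀)‖ ≤ C * M ^ (d + n * N) := by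
  classical
  set Km : Subgroup (GL (Fin n) F) := congruenceGL n (valuation F ϖ ^ m) with hKm
  obtain ⟨M, hM1, hM⟩ := exists_norm_apply_zpowDiagGL_le hϖ hm ρ hρ
  -- the finite `GL_n(𝒪)`-orbits of `v₀` and `φ₀`
  have hO₁ : ((fun k : GL (Fin n) F => ρ k v₀) '' (glInt n F : Set (GL (Fin n) F))).Finite :=
    hρ.finite_image_apply (isCompact_glInt n F) v₀
  have hO₂ : ((fun k : GL (Fin n) F => ρ.dual k φ₀) '' (glInt n F : Set (GL (Fin n) F))).Finite := by
    have h := ρ.isSmooth_contragredientRep.finite_image_apply (isCompact_glInt n F) ⟨φ₀, hφ₀⟩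
    have e : ((fun k : GL (Fin n) F => ρ.dual k φ₀) '' (glInt n F : Set (GL (Fin n) F))) =
        Representation.Contragredient.subtype ρ ''
          ((fun k : GL (Fin n) F => ρ.contragredientRep k ⟨φ₀, hφ₀⟩) ''
            (glInt n F : Set (GL (Fin n) F))) := by
      rw [Set.image_image]; rfl
    rw [e]
    exact h.image _
  -- invariance properties along the orbits
  have hφ₀K' : ∀ g ∈ Km, ∀ u, φ₀ (ρ g u) = φ₀ u := by
    intro g hg u
    have h := LinearMap.congr_fun (hφ₀K g⁻¹ (Km.inv_mem hg)) u
    simpa only [Representation.dual_apply, inv_inv, Module.Dual.transpose_apply,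
      LinearMap.comp_apply] using h
  have hW : ∀ k ∈ glInt n F, ρ k v₀ ∈ ρ.fixedPoints Km := by
    intro k hk
    rw [Representation.mem_fixedPoints]
    intro g hg
    have hconj : k⁻¹ * g * k⁻¹⁻¹ ∈ Km := conj_mem_congruenceGL (Subgroup.inv_mem _ hk) hg
    rw [inv_inv] at hconj
    have h := (ρ.mem_fixedPoints Km v₀).1 hv₀ _ hconj
    have e : k * (k⁻¹ * g * k) = g * k := by group
    calc ρ g (ρ k v₀) = ρ (g * k) v₀ := by rw [map_mul, Module.End.mul_apply]
      _ = ρ (k * (k⁻¹ * g * k)) v₀ := by rw [e]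
      _ = ρ k (ρ (k⁻¹ * g * k) v₀) := by rw [map_mul, Module.End.mul_apply]
      _ = ρ k v₀ := by rw [h]
  have hΨ : ∀ k ∈ glInt n F, ∀ g ∈ Km, ∀ v, (ρ.dual k φ₀) (ρ g v) = (ρ.dual k φ₀) v := by
    intro k hk g hg v
    have hconj : k⁻¹ * g * k⁻¹⁻¹ ∈ Km := conj_mem_congruenceGL (Subgroup.inv_mem _ hk) hg
    rw [inv_inv] at hconj
    simp only [Representation.dual_apply, Module.Dual.transpose_apply, LinearMap.comp_apply]
    have e : k⁻¹ * g = k⁻¹ * g * k * k⁻¹ := by group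
    calc φ₀ (ρ k⁻¹ (ρ g v)) = φ₀ (ρ (k⁻¹ * g) v) := by rw [map_mul, Module.End.mul_apply]
      _ = φ₀ (ρ (k⁻¹ * g * k) (ρ k⁻¹ v)) := by
          conv_lhs => rw [e]
          rw [map_mul, Module.End.mul_apply]
      _ = φ₀ (ρ k⁻¹ v) := hφ₀K' _ hconj _
  -- a uniform constant over the two finite orbits
  have key : ∀ w ∈ (fun k : GL (Fin n) F => ρ k v₀) '' (glInt n F : Set (GL (Fin n) F)),
      ∀ ψ ∈ (fun k : GL (Fin n) F => ρ.dual k φ₀) '' (glInt n F : Set (GL (Fin n) F)),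
      ∃ C : ℝ, 0 ≤ C ∧ ∀ a : Fin n → ℤ, Antitone a →
        ‖ψ (ρ (zpowDiagGL hϖ.ne_zero a) w)‖ ≤ C * M ^ (∑ i, (a i).natAbs) := by
    rintro w ⟨k, hk, rfl⟩ ψ ⟨k', hk', rfl⟩
    exact hM _ (hW k hk) _ (hΨ k' hk')
  choose! Cf hCf0 hCf using key
  set C : ℝ := ∑ w ∈ hO₁.toFinset, ∑ ψ ∈ hO₂.toFinset, Cf w ψ with hC
  have hC0 : 0 ≤ C := Finset.sum_nonneg fun w hw => Finset.sum_nonneg fun ψ hψ =>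
    hCf0 w ((Set.Finite.mem_toFinset hO₁).1 hw) ψ ((Set.Finite.mem_toFinset hO₂).1 hψ)
  have hCle : ∀ w ∈ (fun k : GL (Fin n) F => ρ k v₀) '' (glInt n F : Set (GL (Fin n) F)),
      ∀ ψ ∈ (fun k : GL (Fin n) F => ρ.dual k φ₀) '' (glInt n F : Set (GL (Fin n) F)),
      Cf w ψ ≤ C := by
    intro w hw ψ hψ
    rw [hC]
    refine le_trans ?_ (Finset.single_le_sum (f := fun w => ∑ ψ ∈ hO₂.toFinset, Cf w ψ)
      (fun w' hw' => Finset.sum_nonneg fun ψ' hψ' => hCf0 w' ((Set.Finite.mem_toFinset hO₁).1 hw')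
        ψ' ((Set.Finite.mem_toFinset hO₂).1 hψ')) ((Set.Finite.mem_toFinset hO₁).2 hw))
    exact Finset.single_le_sum (f := fun ψ' => Cf w ψ')
      (fun ψ' hψ' => hCf0 w hw ψ' ((Set.Finite.mem_toFinset hO₂).1 hψ'))
      ((Set.Finite.mem_toFinset hO₂).2 hψ)
  refine ⟨M, hM1, C, hC0, fun N d x hx => ?_⟩
  -- Cartan decomposition of `ϖ^N x ∈ Δ_d`
  obtain ⟨k₁, hk₁, k₂, hk₂, a, ha, hasum, hcartan⟩ :=
    exists_glInt_mul_mul_eq_piPowGL_of_mem_glIntDet hϖ hx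
  set z : GL (Fin n) F := zpowDiagGL hϖ.ne_zero (fun _ : Fin n => (N : ℤ)) with hz
  have hx' : x = k₁⁻¹ * zpowDiagGL hϖ.ne_zero (fun i => (a i : ℤ) - N) * k₂⁻¹ := by
    have e1 : zpowDiagGL hϖ.ne_zero (fun i => (a i : ℤ) - N) = z⁻¹ * piPowGL hϖ.ne_zero a := by
      rw [hz, ← zpowDiagGL_neg, ← zpowDiagGL_natCast, ← zpowDiagGL_add]
      congr 1; funext i; simp only [Pi.add_apply, Pi.neg_apply]; ring
    have hcomm : k₁ * z = z * k₁ := mul_zpowDiagGL_const_comm hϖ.ne_zero _ k₁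
    rw [e1, ← hcartan]
    calc x = k₁⁻¹ * z⁻¹ * (z * k₁) * x := by group
      _ = k₁⁻¹ * z⁻¹ * (k₁ * z) * x := by rw [← hcomm]
      _ = k₁⁻¹ * (z⁻¹ * (k₁ * (z * x) * k₂)) * k₂⁻¹ := by group
  have hanti : Antitone fun i => (a i : ℤ) - N := fun i j hij => by
    have := ha hij; simp only; omega
  -- the coefficient as `ψ(ρ(ϖ^{a-N}) w)`
  have hcoe : φ₀ (ρ x v₀) = (ρ.dual k₁ φ₀) (ρ (zpowDiagGL hϖ.ne_zero fun i => (a i : ℤ) - N)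
      (ρ k₂⁻¹ v₀)) := by
    rw [hx']
    simp only [map_mul, Module.End.mul_apply, Representation.dual_apply,
      Module.Dual.transpose_apply, LinearMap.comp_apply]
  rw [hcoe]
  have hw : ρ k₂⁻¹ v₀ ∈ (fun k : GL (Fin n) F => ρ k v₀) '' (glInt n F : Set (GL (Fin n) F)) :=
    ⟨k₂⁻¹, Subgroup.inv_mem _ hk₂, rfl⟩
  have hψ : ρ.dual k₁ φ₀ ∈ (fun k : GL (Fin n) F => ρ.dual k φ₀) '' (glInt n F : Set (GL (Fin n) F)) :=
    ⟨k₁, hk₁, rfl⟩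
  refine (hCf _ hw _ hψ _ hanti).trans ?_
  have hsum : ∑ i, ((a i : ℤ) - N).natAbs ≤ d + n * N := by
    calc ∑ i, ((a i : ℤ) - N).natAbs ≤ ∑ i, (a i + N) :=
          Finset.sum_le_sum fun i _ => by omega
      _ = d + n * N := by
          rw [Finset.sum_add_distrib, hasum, Finset.sum_const, Finset.card_univ, Fintype.card_fin,
            smul_eq_mul]
  exact mul_le_mul (hCle _ hw _ hψ) (pow_le_pow_right₀ hM1 hsum) (by positivity) hC0


end Assembly

end Literature.NumberTheory.Automorphic
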